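import Literature.MathematicalPhysics.QuantumLattice.HubbardNNNHoppingCut
import Literature.MathematicalPhysics.QuantumLattice.HubbardTorus2DTiling
import HarnessLib

/-!
# Tiling and filling inequalities for the `t–t'` Hubbard ground-state energies on two-dimensional
# tori

Family `hubbard` (topic `MathematicalPhysics/QuantumLattice`); continuation of
`HubbardNNNHoppingCut.lean` (the major cut `groundEnergy_hubbardRectTorusTT'_cut` of the
rectangular `t–t'` torus, swap invariance) towards the thermodynamic limit of the sector
ground-state energies `E_{L×L}(N) = groundEnergy (hubbardRectTorusTT' L L t t' U) N` of the published
`t–t'` Hubbard model (LeBlanc et al. PRX 5 (2015) 041041 eq. (1); Xu et al. Science 384 (2024)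
eq. (1)). Subadditivity à la Ruelle (*Statistical Mechanics* (1969), §2.2, §3.3), in the three
shapes the Fekete argument along squares (`SquareTilingLimit.tendsto_of_tiling_of_filling`) consumes
— verbatim the `t' = 0` file `HubbardTorus2DTiling.lean` with the diagonal seam added:

* a priori bounds: for a two-graph Hamiltonian `hamiltonian G t U + hamiltonian G' t' U'` with
  `≤ P`, `≤ P'` ordered bonds and `U, U' ≥ 0`,
  `-(2|t|P + 2|t'|P') ≤ E(N) ≤ 2|t|P + 2|t'|P' + (U + U')|Λ|` (`groundEnergy_twoGraph_mem_Icc`); on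
  `ℤ/aℤ × ℤ/bℤ` every site has `≤ 4` nearest and `≤ 4` diagonal neighbours, so
  `-(8|t| + 8|t'|) ab ≤ E_{a×b}(N) ≤ (8|t| + 8|t'| + U) ab` (`groundEnergy_hubbardRectTorusTT'_mem_Icc`);
* **tiling** (`groundEnergy_hubbardRectTorusTT'_strip`, `groundEnergy_hubbardRectTorusTT'_square_tiling`):
  `E_{(k+1)M}(Σ N_{ij}) ≤ Σ E_M(N_{ij}) + (16|t| + 32|t'|) M k (k+1)`;
* **filling** (`groundEnergy_hubbardRectTorusTT'_square_fill`): for `U ≥ 0`,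
  `E_{ℓ+r}(N + N_B) ≤ E_ℓ(N) + (8|t| + 8|t'| + U)((ℓ+r)² - ℓ²) + (8|t| + 16|t'|)(2ℓ + r)`.

Everything is proved; no definition.

## References

* D. Ruelle, *Statistical Mechanics: Rigorous Results* (Benjamin, 1969), §2.2 (van Hove sequences
  of boxes, subadditivity of the ground-state energy), §3.3. [cite: Ruelle1969, §3.3]
* J. P. F. LeBlanc et al., Phys. Rev. X 5 (2015) 041041, eq. (1). [cite: LeBlancEtAl2015, eq. (1)]
-/

noncomputable section

open Matrix Finset
open scoped ComplexOrder BigOperators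

namespace Literature.MathematicalPhysics.QuantumLattice

namespace ThermodynamicLimit

/-! ### A priori bounds -/

/-- Every site of `ℤ/aℤ × ℤ/bℤ` has at most four diagonal neighbours. [folklore] -/
private theorem card_filter_fermionRectTorusDiagGraph_adj_le (a b : ℕ) (p : Fin a ×ₗ Fin b) :
    #{q | (fermionRectTorusDiagGraph a b).Adj p q} ≤ 4 := by
  set x : ℕ := ((ofLex p).1 : ℕ) with hx
  set y : ℕ := ((ofLex p).2 : ℕ) with hy
  calc #{q | (fermionRectTorusDiagGraph a b).Adj p q}
      ≤ #({((x + 1) % a, (y + 1) % b), ((x + 1) % a, (y + (b - 1)) % b),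
            ((x + (a - 1)) % a, (y + 1) % b), ((x + (a - 1)) % a, (y + (b - 1)) % b)} :
          Finset (ℕ × ℕ)) := by
        refine Finset.card_le_card_of_injOn (fun q => (((ofLex q).1 : ℕ), ((ofLex q).2 : ℕ))) ?_ ?_
        · intro q hq
          rw [Finset.mem_coe, Finset.mem_filter, fermionRectTorusDiagGraph_adj_iff] at hq
          simp only [Finset.coe_insert, Finset.coe_singleton, Set.mem_insert_iff,
            Set.mem_singleton_iff, Prod.mk.injEq]
          obtain ⟨-, ⟨-, h1 | h1⟩, ⟨-, h2 | h2⟩⟩ := hq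
          · exact Or.inl ⟨h1.symm, h2.symm⟩
          · exact Or.inr (Or.inl ⟨h1.symm, eq_mod_of_succ_mod_eq (ofLex p).2.isLt (ofLex q).2.isLt h2⟩)
          · exact Or.inr (Or.inr (Or.inl
              ⟨eq_mod_of_succ_mod_eq (ofLex p).1.isLt (ofLex q).1.isLt h1, h2.symm⟩))
          · exact Or.inr (Or.inr (Or.inr ⟨eq_mod_of_succ_mod_eq (ofLex p).1.isLt (ofLex q).1.isLt h1,
              eq_mod_of_succ_mod_eq (ofLex p).2.isLt (ofLex q).2.isLt h2⟩))
        · intro q _ q' _ h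
          simp only [Prod.mk.injEq] at h
          exact ofLex.injective (Prod.ext (Fin.ext h.1) (Fin.ext h.2))
    _ ≤ 4 := Finset.card_le_four

/-- The ordered diagonal pairs of `ℤ/aℤ × ℤ/bℤ` number at most `4ab`. [folklore] -/
private theorem card_filter_fermionRectTorusDiagGraph_adj_pair_le (a b : ℕ) :
    #{pq : (Fin a ×ₗ Fin b) × (Fin a ×ₗ Fin b) | (fermionRectTorusDiagGraph a b).Adj pq.1 pq.2} ≤
      4 * (a * b) := by
  calc #{pq : (Fin a ×ₗ Fin b) × (Fin a ×ₗ Fin b) | (fermionRectTorusDiagGraph a b).Adj pq.1 pq.2}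
      = ∑ p : Fin a ×ₗ Fin b, #{q | (fermionRectTorusDiagGraph a b).Adj p q} := by
        rw [← Finset.card_sigma]
        refine Finset.card_bij' (fun pq _ => ⟨pq.1, pq.2⟩) (fun q _ => (q.1, q.2)) ?_ ?_ ?_ ?_
        · intro pq hpq; simpa using hpq
        · intro q hq; simpa using hq
        · intro _ _; rfl
        · intro _ _; rfl
    _ ≤ ∑ _p : Fin a ×ₗ Fin b, 4 := Finset.sum_le_sum fun p _ =>
        card_filter_fermionRectTorusDiagGraph_adj_le a b p
    _ = 4 * (a * b) := by
        rw [Finset.sum_const, Finset.card_univ, smul_eq_mul, mul_comm, card_rectSites]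

section Bounds

variable {Λ : Type*} [LinearOrder Λ] [Fintype Λ]

/-- The energy of a unit vector under one graph Hamiltonian with `≤ P` ordered bonds and `U ≥ 0`
lies in `[-2|t|P, 2|t|P + U|Λ|]`. [folklore] -/
private theorem re_dotProduct_hamiltonian_mem_Icc (G : SimpleGraph Λ) [DecidableRel G.Adj] (t : ℝ)
    {U : ℝ} (hU : 0 ≤ U) {P : ℕ} (hP : #{pq : Λ × Λ | G.Adj pq.1 pq.2} ≤ P) {ψ : Fock (Orb Λ)}
    (hψ1 : star ψ ⬝ᵥ ψ = 1) :
    (star ψ ⬝ᵥ (hamiltonian G t U *ᵥ ψ)).re ∈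
      Set.Icc (-(2 * |t| * P)) (2 * |t| * P + U * Fintype.card Λ) := by
  rw [dotProduct_hamiltonian_mulVec, Complex.add_re]
  set A : ℂ := ∑ x, ∑ y, ∑ σ : Fin 2, (if G.Adj x y then
      star (annihilation (orb x σ) *ᵥ ψ) ⬝ᵥ (annihilation (orb y σ) *ᵥ ψ) else 0) with hA
  have hAn : ‖A‖ ≤ 2 * P := norm_hoppingSum_le G hψ1 hP
  have h2 : |(-(t : ℂ) * A).re| ≤ |t| * ‖A‖ :=
    (Complex.abs_re_le_norm _).trans_eq (by rw [norm_mul, norm_neg, Complex.norm_real,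
      Real.norm_eq_abs])
  have h3 : |t| * ‖A‖ ≤ |t| * (2 * P) := mul_le_mul_of_nonneg_left hAn (abs_nonneg t)
  have h4 := neg_le_of_abs_le h2
  have h4' := le_of_abs_le h2
  have hD0 : 0 ≤ ((U : ℂ) * ∑ x, star ψ ⬝ᵥ (numberOp x 0 *ᵥ (numberOp x 1 *ᵥ ψ))).re := by
    rw [Complex.re_ofReal_mul, Complex.re_sum]
    exact mul_nonneg hU (Finset.sum_nonneg fun x _ => re_dotProduct_numberOp_numberOp_nonneg ψ x)
  have hD1 : ((U : ℂ) * ∑ x, star ψ ⬝ᵥ (numberOp x 0 *ᵥ (numberOp x 1 *ᵥ ψ))).re ≤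
      U * Fintype.card Λ := by
    rw [Complex.re_ofReal_mul, Complex.re_sum]
    refine mul_le_mul_of_nonneg_left ?_ hU
    calc ∑ x, (star ψ ⬝ᵥ (numberOp x 0 *ᵥ (numberOp x 1 *ᵥ ψ))).re
        ≤ ∑ _x : Λ, (1 : ℝ) := Finset.sum_le_sum fun x _ =>
          (re_dotProduct_numberOp_numberOp_le ψ x).trans (by rw [hψ1, Complex.one_re])
      _ = Fintype.card Λ := by simp
  constructor <;> linarith

/-- **A priori bounds on the sector energies of a two-graph Hamiltonian.** With at most `P`
(`P'`) ordered bonds of `G` (`G'`) and `U, U' ≥ 0`: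
`-(2|t|P + 2|t'|P') ≤ E(N) ≤ 2|t|P + 2|t'|P' + (U + U')|Λ|` for every nonempty sector `N ≤ 2|Λ|`
(stability of finite-range lattice interactions, Ruelle §2.2). [cite: Ruelle1969, §2.2] -/
theorem groundEnergy_twoGraph_mem_Icc (G G' : SimpleGraph Λ) [DecidableRel G.Adj]
    [DecidableRel G'.Adj] (t t' : ℝ) {U U' : ℝ} (hU : 0 ≤ U) (hU' : 0 ≤ U') {P P' : ℕ}
    (hP : #{pq : Λ × Λ | G.Adj pq.1 pq.2} ≤ P) (hP' : #{pq : Λ × Λ | G'.Adj pq.1 pq.2} ≤ P')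
    {N : ℕ} (hN : N ≤ 2 * Fintype.card Λ) :
    groundEnergy (hamiltonian G t U + hamiltonian G' t' U') N ∈
      Set.Icc (-(2 * |t| * P + 2 * |t'| * P'))
        (2 * |t| * P + 2 * |t'| * P' + (U + U') * Fintype.card Λ) := by
  have hc : N ≤ Fintype.card (Orb Λ) := by rwa [card_orb]
  have key : ∀ ψ : Fock (Orb Λ), star ψ ⬝ᵥ ψ = 1 →
      (expect (hamiltonian G t U + hamiltonian G' t' U') ψ).re ∈
        Set.Icc (-(2 * |t| * P + 2 * |t'| * P'))
          (2 * |t| * P + 2 * |t'| * P' + (U + U') * Fintype.card Λ) := by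
    intro ψ hψ1
    unfold QuantumLattice.expect
    rw [add_mulVec, dotProduct_add, Complex.add_re]
    have h1 := re_dotProduct_hamiltonian_mem_Icc G t hU hP hψ1
    have h2 := re_dotProduct_hamiltonian_mem_Icc G' t' hU' hP' hψ1
    constructor <;> linarith [h1.1, h1.2, h2.1, h2.2]
  constructor
  · refine le_csInf (groundEnergySet_nonempty _ hc) ?_
    rintro E ⟨ψ, -, hψ1, rfl⟩
    exact (key ψ hψ1).1
  · obtain ⟨E, ⟨ψ, hψN, hψ1, rfl⟩⟩ :=
      groundEnergySet_nonempty (hamiltonian G t U + hamiltonian G' t' U') hc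
    exact (groundEnergy_le_re_expect _ hψN hψ1).trans (key ψ hψ1).2

end Bounds

/-- On `ℤ/aℤ × ℤ/bℤ` with `U ≥ 0`: `-(8|t| + 8|t'|) ab ≤ E(N) ≤ (8|t| + 8|t'| + U) ab` for the
`t–t'` sector energies (`≤ 4ab` ordered nearest-neighbour and `≤ 4ab` ordered diagonal pairs).
[cite: Ruelle1969, §2.2] -/
theorem groundEnergy_hubbardRectTorusTT'_mem_Icc (a b : ℕ) (t t' : ℝ) {U : ℝ} (hU : 0 ≤ U)
    {N : ℕ} (hN : N ≤ 2 * (a * b)) :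
    groundEnergy (hubbardRectTorusTT' a b t t' U) N ∈
      Set.Icc (-((8 * |t| + 8 * |t'|) * (a * b))) ((8 * |t| + 8 * |t'| + U) * (a * b)) := by
  have h := groundEnergy_twoGraph_mem_Icc (fermionRectTorusGraph a b) (fermionRectTorusDiagGraph a b)
    t t' hU le_rfl (card_filter_fermionRectTorusGraph_adj_pair_le a b)
    (card_filter_fermionRectTorusDiagGraph_adj_pair_le a b) (N := N) (by rwa [card_rectSites])
  rw [card_rectSites] at h
  unfold hubbardRectTorusTT'
  push_cast at h
  constructor <;> nlinarith [h.1, h.2, abs_nonneg t, abs_nonneg t']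

/-! ### Tiling: strips and squares -/

/-- **Strips.** Cutting `ℤ/(k+1)Mℤ × ℤ/bℤ` into `k+1` copies of `ℤ/Mℤ × ℤ/bℤ` (arbitrary block
particle numbers `N_i ≤ 2Mb`) costs at most `(8|t| + 16|t'|) b` per cut. [cite: Ruelle1969, §2.2] -/
theorem groundEnergy_hubbardRectTorusTT'_strip (M b : ℕ) (t t' U : ℝ) :
    ∀ (k : ℕ) (Ns : Fin (k + 1) → ℕ), (∀ i, Ns i ≤ 2 * (M * b)) →
      groundEnergy (hubbardRectTorusTT' ((k + 1) * M) b t t' U) (∑ i, Ns i) ≤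
        ∑ i, groundEnergy (hubbardRectTorusTT' M b t t' U) (Ns i) + (8 * |t| + 16 * |t'|) * b * k := by
  intro k
  induction k with
  | zero =>
      intro Ns _
      rw [show (0 + 1) * M = M by ring, Fin.sum_univ_one, Fin.sum_univ_one]
      simp
  | succ k ih =>
      intro Ns hNs
      have eN : ∑ i, Ns i = ∑ i : Fin (k + 1), Ns (Fin.castSucc i) + Ns (Fin.last _) :=
        Fin.sum_univ_castSucc _
      have eE : ∑ i, groundEnergy (hubbardRectTorusTT' M b t t' U) (Ns i) =
          ∑ i : Fin (k + 1), groundEnergy (hubbardRectTorusTT' M b t t' U) (Ns (Fin.castSucc i)) +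
            groundEnergy (hubbardRectTorusTT' M b t t' U) (Ns (Fin.last _)) :=
        Fin.sum_univ_castSucc _
      rw [show (k + 1 + 1) * M = (k + 1) * M + M by ring, eN, eE]
      have h1 : ∑ i : Fin (k + 1), Ns (Fin.castSucc i) ≤ 2 * ((k + 1) * M * b) := by
        calc ∑ i : Fin (k + 1), Ns (Fin.castSucc i) ≤ ∑ _i : Fin (k + 1), 2 * (M * b) :=
              Finset.sum_le_sum fun i _ => hNs _
          _ = 2 * ((k + 1) * M * b) := by
              rw [Finset.sum_const, Finset.card_univ, Fintype.card_fin, smul_eq_mul]; ring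
      have hcut := groundEnergy_hubbardRectTorusTT'_cut ((k + 1) * M) M b t t' U h1 (hNs (Fin.last _))
      have hih := ih (fun i => Ns (Fin.castSucc i)) (fun i => hNs _)
      push_cast at hcut hih ⊢
      linarith

/-- **Squares.** Tiling `ℤ/(k+1)Mℤ × ℤ/(k+1)Mℤ` by `(k+1)²` copies of `ℤ/Mℤ × ℤ/Mℤ` with particle
numbers `N_{ij} ≤ 2M²`: `E_{(k+1)M}(Σ N_{ij}) ≤ Σ E_M(N_{ij}) + (16|t| + 32|t'|) M k (k+1)` (strips in
the major direction, the coordinate swap, strips again). [cite: Ruelle1969, §2.2] -/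
theorem groundEnergy_hubbardRectTorusTT'_square_tiling (M : ℕ) (t t' U : ℝ) (k : ℕ)
    (Ns : Fin (k + 1) → Fin (k + 1) → ℕ) (hNs : ∀ i j, Ns i j ≤ 2 * (M * M)) :
    groundEnergy (hubbardRectTorusTT' ((k + 1) * M) ((k + 1) * M) t t' U) (∑ i, ∑ j, Ns i j) ≤
      ∑ i, ∑ j, groundEnergy (hubbardRectTorusTT' M M t t' U) (Ns i j) +
        (16 * |t| + 32 * |t'|) * M * k * (k + 1) := by
  -- strips in the major direction, blocks `M × (k+1)M`
  have hS : ∀ i, ∑ j, Ns i j ≤ 2 * (M * ((k + 1) * M)) := by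
    intro i
    calc ∑ j, Ns i j ≤ ∑ _j : Fin (k + 1), 2 * (M * M) := Finset.sum_le_sum fun j _ => hNs i j
      _ = 2 * (M * ((k + 1) * M)) := by
          rw [Finset.sum_const, Finset.card_univ, Fintype.card_fin, smul_eq_mul]; ring
  have h1 := groundEnergy_hubbardRectTorusTT'_strip M ((k + 1) * M) t t' U k (fun i => ∑ j, Ns i j) hS
  -- each strip: swap, then strips again
  have h2 : ∀ i, groundEnergy (hubbardRectTorusTT' M ((k + 1) * M) t t' U) (∑ j, Ns i j) ≤
      ∑ j, groundEnergy (hubbardRectTorusTT' M M t t' U) (Ns i j) + (8 * |t| + 16 * |t'|) * M * k := by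
    intro i
    rw [← groundEnergy_hubbardRectTorusTT'_swap]
    exact groundEnergy_hubbardRectTorusTT'_strip M M t t' U k (Ns i) (hNs i)
  have h3 : ∑ i, groundEnergy (hubbardRectTorusTT' M ((k + 1) * M) t t' U) (∑ j, Ns i j) ≤
      ∑ i, (∑ j, groundEnergy (hubbardRectTorusTT' M M t t' U) (Ns i j) +
        (8 * |t| + 16 * |t'|) * M * k) :=
    Finset.sum_le_sum fun i _ => h2 i
  rw [Finset.sum_add_distrib, Finset.sum_const, Finset.card_univ, Fintype.card_fin,
    nsmul_eq_mul] at h3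
  push_cast at h1 h3 ⊢
  nlinarith [h1, h3, abs_nonneg t, abs_nonneg t']

/-! ### Filling the complement of a square in a bigger square -/

/-- **Monotonicity up to the complement.** For `U ≥ 0`, a trial state of the big `t–t'` torus
`ℤ/(ℓ+r)ℤ × ℤ/(ℓ+r)ℤ` made of a state of the corner torus `ℓ × ℓ` and arbitrary states of the two
complementary rectangles `r × ℓ`, `r × (ℓ+r)` carrying `N_B ≤ 2((ℓ+r)² - ℓ²)` particles:
`E_{ℓ+r}(N + N_B) ≤ E_ℓ(N) + (8|t| + 8|t'| + U)((ℓ+r)² - ℓ²) + (8|t| + 16|t'|)(2ℓ + r)`.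
[cite: Ruelle1969, §2.2] -/
theorem groundEnergy_hubbardRectTorusTT'_square_fill (ℓ r : ℕ) (t t' : ℝ) {U : ℝ} (hU : 0 ≤ U)
    {N NB : ℕ} (hN : N ≤ 2 * (ℓ * ℓ)) (hNB : NB ≤ 2 * (r * ℓ + r * (ℓ + r))) :
    groundEnergy (hubbardRectTorusTT' (ℓ + r) (ℓ + r) t t' U) (N + NB) ≤
      groundEnergy (hubbardRectTorusTT' ℓ ℓ t t' U) N +
        (8 * |t| + 8 * |t'| + U) * (r * ℓ + r * (ℓ + r)) + (8 * |t| + 16 * |t'|) * (2 * ℓ + r) := by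
  -- split the extra particles between the two rectangles
  set N₁ : ℕ := min NB (2 * (r * ℓ)) with hN₁
  set N₂ : ℕ := NB - N₁ with hN₂
  have hN₁le : N₁ ≤ 2 * (r * ℓ) := min_le_right _ _
  have hN₁le' : N₁ ≤ NB := min_le_left _ _
  have hNB' : NB = N₁ + N₂ := by omega
  have hN₂le : N₂ ≤ 2 * (r * (ℓ + r)) := by
    rcases le_total NB (2 * (r * ℓ)) with h | h
    · have : N₁ = NB := min_eq_left h
      omega
    · have : N₁ = 2 * (r * ℓ) := min_eq_right h
      omega
  -- big cut along the major direction: blocks `ℓ × (ℓ+r)` and `r × (ℓ+r)`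
  have hA : N + N₁ ≤ 2 * (ℓ * (ℓ + r)) := by nlinarith
  have hcut1 := groundEnergy_hubbardRectTorusTT'_cut ℓ r (ℓ + r) t t' U hA hN₂le
  -- the first block: swap and cut again into `ℓ × ℓ` and `r × ℓ`
  have hcut2 := groundEnergy_hubbardRectTorusTT'_cut ℓ r ℓ t t' U hN hN₁le
  rw [groundEnergy_hubbardRectTorusTT'_swap] at hcut2
  -- crude bounds on the two rectangles
  have hB1 := (groundEnergy_hubbardRectTorusTT'_mem_Icc r ℓ t t' hU hN₁le).2
  have hB2 := (groundEnergy_hubbardRectTorusTT'_mem_Icc r (ℓ + r) t t' hU hN₂le).2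
  rw [hNB', ← add_assoc]
  push_cast at hcut1 hcut2 hB1 hB2 ⊢
  nlinarith [hcut1, hcut2, hB1, hB2, abs_nonneg t, abs_nonneg t']

end ThermodynamicLimit

end Literature.MathematicalPhysics.QuantumLattice

end
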